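import Summits.FinalStateConjecture.FinalStateConjecture.Theorems.ZeroEnergyKerrOrBombKerrOrBombCensus
import Summits.FinalStateConjecture.FinalStateConjecture.Theorems.ZeroEnergyKerrOrBombZeroEnergyRigidityStubFuturePresentation

/-!
# Crux `KerrOrBomb` (stmt-FinalStateConjecture-10689) — the census with residue S1b DISCHARGED

Line lead c10 (prover-line-stmt-FinalStateConjecture-10689-c10-0), line `Dock`, 2026-08-16.

The kernel-checked census of the typed crux (`KerrOrBomb.Census.kerrOrBomb_of_residues`, lead c9,
p110860) has six hypotheses: S1b (WLOG future-presented), S1c (horizon completion to an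
`I⁺`-regular re-presentation) and the four Literature named facts Sudarsky–Wald 1993,
Chruściel–Galloway 2010, Beig–Chruściel 1997, Chruściel–Costa–Heusler 2012.  S1b is now a tree
theorem (`ZeroEnergyRigidity.GlobalHorizonKillingField.stub_futurePresentation`,
`…ZeroEnergyRigidityStubFuturePresentation.lean`, this lead), so the census drops to FIVE residues:
`kerrOrBomb_of_five_residues : S1c → SW93 → CG10 → BC97 → CCH12 → KerrOrBomb`.  As before this is a
CONDITIONAL result (no `sorry`; five hypotheses — one unpublished completion lemma, which carries
all the non-classical content of smooth stationary black-hole uniqueness, and four deep published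
theorems), and the mode-stability hypothesis (h6) of the typed crux stays idle on this path.
Chruściel–Costa–Heusler, Living Rev. Relativ. 15 (2012) 7, §3; Chruściel–Costa, Astérisque 321
(2008), Def. 1.1 and Thm. 1.3.
-/

noncomputable section

-- `Summit.FinalStateConjecture.FinalStateConjecture.…`: summit = problem name (single-conjunct summit, D-0017).
set_option linter.dupNamespace false

namespace Summit.FinalStateConjecture.FinalStateConjecture.Theorems.KerrOrBomb.Census

open Set Function Literature.Geometry.Lorentzian
open scoped Manifold ContDiff Topology

/-- **Five-residue census of the typed crux `KerrOrBomb`.**  The typed crux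
`…Theses.ZeroEnergyKerrOrBomb.KerrOrBomb` BY NAME follows from: S1c (every future-presented
vacuum presentation with connected non-degenerate horizon, globally hyperbolic carrier and globally
hyperbolic d.o.c. admits an `I⁺`-regular vacuum re-presentation with connected horizon and a
complete `T`-commuting horizon Killing field, whose d.o.c. is isometric onto the given one) and
the four named facts `SudarskyWald1993_staticity`, `ChruscielGalloway2010_docStaticUniqueness`,
`BeigChrusciel1997_axisymmetricCombination`, `ChruscielCostaHeusler2012_axisymmetricUniqueness`
— the six-residue census `kerrOrBomb_of_residues` with its first hypothesis S1b discharged by the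
tree theorem `ZeroEnergyRigidity.GlobalHorizonKillingField.stub_futurePresentation`.  Conditional
result (five hypotheses, no `sorry`).  Chruściel–Costa–Heusler 2012, §3; Chruściel–Costa 2008,
Def. 1.1 and Thm. 1.3. -/
theorem kerrOrBomb_of_five_residues :
    (∀ (𝓑 : Literature.Geometry.Lorentzian.StationaryAFBlackHole.{0}) [𝓑.metric.HasLeviCivita], 𝓑.metric.toPseudoRiemannianMetric.IsRicciFlat → IsConnected 𝓑.horizon → 𝓑.toSpacetime.IsNonDegenerateHorizon 𝓑.Mext → 𝓑.metric.IsGloballyHyperbolic 𝓑.timeOrientation → 𝓑.toSpacetime.IsGloballyHyperbolicSet 𝓑.doc → (∀ p : 𝓑.carrier, p ∈ 𝓑.metric.chronologicalFuture 𝓑.timeOrientation 𝓑.Mext) → ∃ (𝓑' : Literature.Geometry.Lorentzian.StationaryAFBlackHole.{0}) (_ : 𝓑'.metric.HasLeviCivita), 𝓑'.metric.toPseudoRiemannianMetric.IsRicciFlat ∧ 𝓑'.IsIPlusRegular ∧ IsConnected 𝓑'.horizon ∧ (∃ K' : Π x : 𝓑'.carrier, TangentSpace (𝓡 4) x, 𝓑'.metric.IsKillingField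 K' ∧ Literature.Geometry.Lorentzian.IsCompleteVectorField K' ∧ (∀ x, VectorField.mlieBracket (𝓡 4) 𝓑'.killing K' x = 0) ∧ (∀ p ∈ 𝓑'.horizon, K' p ≠ 0) ∧ (∀ γ : ℝ → 𝓑'.carrier, IsMIntegralCurve γ K' → γ 0 ∈ 𝓑'.horizon → ∀ t, γ t ∈ 𝓑'.horizon) ∧ ∃ κ : ℝ, κ ≠ 0 ∧ ∀ p ∈ 𝓑'.horizon, 𝓑'.metric.leviCivita K' p (K' p) = κ • K' p) ∧ ∃ Θ : ↥(𝓑'.docOpens Literature.Geometry.Lorentzian.LorentzianMetric.isOpen_chronologicalFuture_holds_of_boundaryless Literature.Geometry.Lorentzian.LorentzianMetric.isOpen_chronologicalPast_holds_of_boundaryless) → 𝓑.carrier, Function.Injective Θ ∧ Set.range Θ = 𝓑.doc ∧ Literature.Geometry.Lorentzian.PseudoRiemannianMetric.IsIsometricImmersion (𝓑'.metric.restrict Literature.Geometry.Lorentzian.PseudoRiemannianMetric.contMDiff_restrict_holds (𝓑'.docOpens Literature.Geometry.Lorentzian.LorentzianMetric.isOpen_chronologicalFuture_holds_of_boundaryless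 Literature.Geometry.Lorentzian.LorentzianMetric.isOpen_chronologicalPast_holds_of_boundaryless)).toPseudoRiemannianMetric 𝓑.metric.toPseudoRiemannianMetric Θ) → Literature.Geometry.Lorentzian.SudarskyWald1993_staticity → Literature.Geometry.Lorentzian.ChruscielGalloway2010_docStaticUniqueness → Literature.Geometry.Lorentzian.BeigChrusciel1997_axisymmetricCombination.{0} → Literature.Geometry.Lorentzian.ChruscielCostaHeusler2012_axisymmetricUniqueness.{0} → Summit.FinalStateConjecture.FinalStateConjecture.Theses.ZeroEnergyKerrOrBomb.KerrOrBomb :=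
  kerrOrBomb_of_residues ZeroEnergyRigidity.GlobalHorizonKillingField.stub_futurePresentation

end Summit.FinalStateConjecture.FinalStateConjecture.Theorems.KerrOrBomb.Census

end
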